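import Mathlib
import Summits.Ventures.PercRepro2.OneEdge
import Summits.Ventures.PercRepro2.KPrimeReduction
import Summits.Ventures.PercRepro2.KPrimeBase
import Summits.Ventures.PercRepro2.KPrimeSure

/-!
# The base case and the degenerate cases of the `v`-exploration of `(K′)`
(blind cell PercRepro2, mine-c g33; `conjectures/MINE-C.md` §42.0)

The `v`-EXPLORATION resolves the edges at the weight-`1` root of `v` (`KPrime.root p ends v`).
When it is EXHAUSTED (every edge leaving the root of `v` has weight `0`) the root of `v` is a closed
component: `a₁ ↮ v` and `a₂ ↮ v` are sure, so `S = N = Ω` on the sure set, the `U`-masses vanish and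
`(K′)` reduces to the one-root positive association of `b ∈ C₁` and `y ∈ C₁` given `a₁ ↮ a₂`
(van den Berg–Kahn, `vdBK_pair`) — or to `P(b ∈ C₁, Ω) ≤ P(Ω)` when `b` sits in the root of `v`:

* `kprime_of_exhausted_v` : `Exhausted p ends v → a₁ ∉ root v → a₂ ∉ root v → (K′)`.

The degenerate cases: `a₁` in the root of `v` kills `N` (the form is `0`), `a₂` in the root of `v`
kills `S` (the form is `0`):

* `kprimeHolds_of_a₁_mem_root_v`, `kprimeHolds_of_a₂_mem_root_v`.
-/

namespace Summit.Ventures.PercRepro2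

namespace KPrime

variable {V : Type*} {E : Type*} [Fintype E] [DecidableEq E] [Fintype V] [DecidableEq V]
  {R : Type*} [Field R] [LinearOrder R] [IsStrictOrderedRing R]

section VBase

variable {ends : E → Sym2 V} {a₁ a₂ b v y : V} {p : E → R}

omit [Fintype V] [IsStrictOrderedRing R] in
/-- `a₁` in the root of `v`: `N` misses the sure set, so `N₀ = D₀ = 0` and the form is `0`. -/
theorem kprimeHolds_of_a₁_mem_root_v (h1 : a₁ ∈ root p ends v) :
    KPrimeHolds ends a₁ a₂ b v y p := by
  have hN : N ends a₁ a₂ v ∩ sureSet p = ∅ := by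
    ext ω
    simp only [Set.mem_inter_iff, Set.mem_empty_iff_false, iff_false, not_and]
    intro hω hs
    exact (mem_N.1 hω).2 (conn_symm (conn_of_mem_root p hs h1))
  have hN0 : prob p (N ends a₁ a₂ v) = 0 := prob_eq_zero_of_inter_sureSet_eq_empty p hN
  have hXN0 : prob p (connEvent ends a₁ b ∩ N ends a₁ a₂ v) = 0 := by
    apply prob_eq_zero_of_inter_sureSet_eq_empty
    rw [Set.inter_assoc, hN, Set.inter_empty]
  unfold KPrimeHolds kprimeForm
  rw [hN0, hXN0]
  simp

omit [Fintype V] [IsStrictOrderedRing R] in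
/-- `a₂` in the root of `v`: `S` misses the sure set, so every `S`-mass is `0` and the form is `0`. -/
theorem kprimeHolds_of_a₂_mem_root_v (h2 : a₂ ∈ root p ends v) :
    KPrimeHolds ends a₁ a₂ b v y p := by
  have hS : S ends a₁ a₂ v ∩ sureSet p = ∅ := by
    ext ω
    simp only [Set.mem_inter_iff, Set.mem_empty_iff_false, iff_false, not_and]
    intro hω hs
    exact (mem_S.1 hω).2 (conn_symm (conn_of_mem_root p hs h2))
  have hS0 : prob p (S ends a₁ a₂ v) = 0 := prob_eq_zero_of_inter_sureSet_eq_empty p hS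
  have hYS0 : prob p (connEvent ends a₂ y ∩ S ends a₁ a₂ v) = 0 := by
    apply prob_eq_zero_of_inter_sureSet_eq_empty
    rw [Set.inter_assoc, hS, Set.inter_empty]
  unfold KPrimeHolds kprimeForm
  rw [hS0, hYS0]
  simp

omit [Fintype E] [DecidableEq E] [Fintype V] [DecidableEq V] [IsStrictOrderedRing R] in
/-- Exhausted at the root of `v`, with `a₁`, `a₂` outside it: on the sure set `a₁ ↮ v` and
`a₂ ↮ v`. -/
lemma sure_facts_v (hex : Exhausted p ends v) (h1 : a₁ ∉ root p ends v)
    (h2 : a₂ ∉ root p ends v) {ω : Config E} (hω : ω ∈ sureSet p) :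
    ¬ Conn ends ω a₁ v ∧ ¬ Conn ends ω a₂ v :=
  ⟨fun h => h1 (mem_root_of_conn p hex hω (conn_symm h)),
    fun h => h2 (mem_root_of_conn p hex hω (conn_symm h))⟩

omit [Fintype E] [DecidableEq E] [Fintype V] [DecidableEq V] in
/-- `Ω` as the complement of `{a₁ ↔ a₂}`. -/
lemma Ω_eq_compl : Ω ends a₁ a₂ = (connEvent ends a₁ a₂)ᶜ := by
  ext ω; simp only [mem_Ω, Set.mem_compl_iff, mem_connEvent]

/-- **The base case of the `v`-exploration**: the root of `v` exhausted and `a₁`, `a₂` outside it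
give `(K′)` — the `U`-masses vanish, `S = N = Ω` on the sure set, and the form is
`P(Ω) · (P(y ∈ C₁, b ∈ C₁ ∪ C(v), Ω) · P(Ω) − P(b ∈ C₁, Ω) · P(y ∈ C₁, Ω)) ≥ 0`
(van den Berg–Kahn `vdBK_pair` when `b` is outside the root of `v`; `P(b ∈ C₁, Ω) ≤ P(Ω)` when
`b` is inside it). -/
theorem kprime_of_exhausted_v (hp : IsProbVec p) (hex : Exhausted p ends v)
    (h1 : a₁ ∉ root p ends v) (h2 : a₂ ∉ root p ends v) :
    KPrimeHolds ends a₁ a₂ b v y p := by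
  have sf := fun {ω : Config E} (hω : ω ∈ sureSet p) => sure_facts_v hex h1 h2 hω
  -- the `U`-masses vanish
  have hU0 : ∀ A : Set (Config E), prob p (connEvent ends a₁ v ∩ A) = 0 := by
    intro A
    apply prob_eq_zero_of_inter_sureSet_eq_empty
    ext ω
    simp only [Set.mem_inter_iff, Set.mem_empty_iff_false, iff_false, not_and, mem_connEvent]
    intro hu hs
    exact (sf hs).1 hu.1
  have z1 : prob p (connEvent ends a₁ v ∩ connEvent ends a₁ b ∩ Ω ends a₁ a₂) = 0 := by
    rw [Set.inter_assoc]; exact hU0 _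
  have z2 : prob p (connEvent ends a₁ v ∩ Ω ends a₁ a₂) = 0 := hU0 _
  have z3 : prob p (connEvent ends a₁ v ∩ connEvent ends a₂ y ∩ connEvent ends a₁ b ∩
      Ω ends a₁ a₂) = 0 := by
    rw [Set.inter_assoc, Set.inter_assoc]; exact hU0 _
  have z4 : prob p (connEvent ends a₁ v ∩ connEvent ends a₂ y ∩ Ω ends a₁ a₂) = 0 := by
    rw [Set.inter_assoc]; exact hU0 _
  -- `S`, `N`, `X ∩ N`, `(0,1)` on the sure set
  have eS : prob p (S ends a₁ a₂ v) = prob p (Ω ends a₁ a₂) := by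
    apply prob_congr_sure
    ext ω
    simp only [Set.mem_inter_iff, mem_S, mem_Ω]
    constructor
    · rintro ⟨⟨ha, _⟩, hs⟩; exact ⟨fun h => ha (conn_symm h), hs⟩
    · rintro ⟨ha, hs⟩; exact ⟨⟨fun h => ha (conn_symm h), (sf hs).2⟩, hs⟩
  have eN : prob p (N ends a₁ a₂ v) = prob p (Ω ends a₁ a₂) := by
    apply prob_congr_sure
    ext ω
    simp only [Set.mem_inter_iff, mem_N, mem_Ω]
    constructor
    · rintro ⟨⟨ha, _⟩, hs⟩; exact ⟨ha, hs⟩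
    · rintro ⟨ha, hs⟩; exact ⟨⟨ha, (sf hs).1⟩, hs⟩
  have eXN : prob p (connEvent ends a₁ b ∩ N ends a₁ a₂ v) =
      prob p (connEvent ends a₁ b ∩ Ω ends a₁ a₂) := by
    apply prob_congr_sure
    ext ω
    simp only [Set.mem_inter_iff, mem_N, mem_Ω]
    constructor
    · rintro ⟨⟨hb, ha, _⟩, hs⟩; exact ⟨⟨hb, ha⟩, hs⟩
    · rintro ⟨⟨hb, ha⟩, hs⟩; exact ⟨⟨hb, ha, (sf hs).1⟩, hs⟩
  have e01 : prob p (cls01 ends a₁ a₂ v y) = prob p (connEvent ends a₁ y ∩ Ω ends a₁ a₂) := by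
    apply prob_congr_sure
    ext ω
    simp only [cls01, Set.mem_inter_iff, Set.mem_compl_iff, mem_connEvent, mem_S, mem_Ω]
    constructor
    · rintro ⟨⟨⟨_, hy⟩, ha, _⟩, hs⟩; exact ⟨⟨hy, fun h => ha (conn_symm h)⟩, hs⟩
    · rintro ⟨⟨hy, ha⟩, hs⟩
      exact ⟨⟨⟨(sf hs).1, hy⟩, fun h => ha (conn_symm h), (sf hs).2⟩, hs⟩
  have hΩ := Ω_eq_compl (ends := ends) (a₁ := a₁) (a₂ := a₂)
  unfold KPrimeHolds kprimeForm
  rw [z1, z2, z3, z4, eS, eN, eXN, e01]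
  have hpΩ := prob_nonneg hp (Ω ends a₁ a₂)
  by_cases hb : b ∈ root p ends v
  · -- `b` in the root of `v`: `b ∈ C(v)` is sure, the glued class is `{y ∈ C₁} ∩ Ω`
    have e01e : prob p (cls01e ends a₁ a₂ b v y) =
        prob p (connEvent ends a₁ y ∩ Ω ends a₁ a₂) := by
      apply prob_congr_sure
      ext ω
      simp only [cls01e, Set.mem_inter_iff, Set.mem_compl_iff, Set.mem_union, mem_connEvent,
        mem_S, mem_Ω]
      constructor
      · rintro ⟨⟨⟨⟨_, hy⟩, ha, _⟩, _⟩, hs⟩; exact ⟨⟨hy, fun h => ha (conn_symm h)⟩, hs⟩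
      · rintro ⟨⟨hy, ha⟩, hs⟩
        exact ⟨⟨⟨⟨(sf hs).1, hy⟩, fun h => ha (conn_symm h), (sf hs).2⟩,
          Or.inr (conn_of_mem_root p hs hb)⟩, hs⟩
    rw [e01e]
    have hmono : prob p (connEvent ends a₁ b ∩ Ω ends a₁ a₂) ≤ prob p (Ω ends a₁ a₂) :=
      prob_mono hp Set.inter_subset_right
    have hW := prob_nonneg hp (connEvent ends a₁ y ∩ Ω ends a₁ a₂)
    nlinarith [mul_nonneg (mul_nonneg hpΩ hW) (sub_nonneg.2 hmono)]
  · -- `b` outside the root of `v`: `b ∈ C(v)` is impossible, the glued class is `{y, b ∈ C₁} ∩ Ω`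
    have e01e : prob p (cls01e ends a₁ a₂ b v y) =
        prob p (connEvent ends a₁ b ∩ connEvent ends a₁ y ∩ Ω ends a₁ a₂) := by
      apply prob_congr_sure
      ext ω
      simp only [cls01e, Set.mem_inter_iff, Set.mem_compl_iff, Set.mem_union, mem_connEvent,
        mem_S, mem_Ω]
      constructor
      · rintro ⟨⟨⟨⟨_, hy⟩, ha, _⟩, hbb⟩, hs⟩
        refine ⟨⟨⟨?_, hy⟩, fun h => ha (conn_symm h)⟩, hs⟩
        rcases hbb with h | h
        · exact h
        · exact absurd (mem_root_of_conn p hex hs h) hb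
      · rintro ⟨⟨⟨hbb, hy⟩, ha⟩, hs⟩
        exact ⟨⟨⟨⟨(sf hs).1, hy⟩, fun h => ha (conn_symm h), (sf hs).2⟩, Or.inl hbb⟩, hs⟩
    rw [e01e]
    have key := vdBK_pair p hp ends a₁ b y a₂
    rw [← hΩ] at key
    nlinarith [mul_nonneg hpΩ (sub_nonneg.2 key)]

end VBase

end KPrime

end Summit.Ventures.PercRepro2
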